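import Literature.NumberTheory.Automorphic.MokWeakBaseChange
import Literature.NumberTheory.Automorphic.AutomorphicRepsGLSatakeFlathProofs
import HarnessLib

/-!
# Mok's weak base change `U_{E/F}(N) → GL_N(𝔸_E)`: the almost-everywhere Satake bookkeeping
# of the vendored form of `Mok2014_weakBaseChange`

Topic `NumberTheory/Automorphic`; sibling proof file of `MokWeakBaseChange` (the named fact
`Mok2014_weakBaseChange`: C. P. Mok, Mem. Amer. Math. Soc. 235 (2015), no. 1108 = arXiv:1206.0882,
Cor. 4.3.8 and the paragraph following it, "corollary 4.3.8 gives in particular the existence of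
"weak base change" associated to discrete automorphic representations on `U_{E/F}(N)` (with respect
to the `L`-embedding `ξ`)").  Theorems only: no definition, no new named fact (D-0026), no `sorry`.

## What is proved here (the last step of the printed proof, in the tree's interface)

The tree renders "`P` is a weak base change of `π`" as an `iff` on Satake parameters at almost
every finite place `w` of `E` (`UnitaryGroup.IsWeakBaseChange`:
`∀ᶠ w in cofinite, ∀ α, HasBaseChangeSatakeAt π w α ↔ P.HasSatakeParamAt w α`), whereas the
printed statement (Cor. 4.3.8 with §2.3: the Hecke eigenfamily `c(π)` is mapped by `ξ_1` to
`c(ψ^N)` outside a finite set of places) is a MATCHING of parameters.  With the discharged `GL_N`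
facts of `AutomorphicRepsGLSatakeFlathProofs` (`hasSatakeParamAt_unique_holds`,
`hasSatakeParamAt_cofinite_holds`; Flath 1979, Thm. 3) we prove:

* `UnitaryGroup.isWeakBaseChange_iff` — `IsWeakBaseChange P π` holds iff (i) at almost every `w`
  some base-change Satake parameter of `π` at `w` is a Satake parameter of `P` at `w` (the printed
  shape, `IsWeakBaseChange.eventually_matching`) and (ii) at almost every `w` the base-change
  Satake parameter of `π` is unique (`IsWeakBaseChange.eventually_unique`; the `U(N)`-side
  analogue of Flath's theorem together with the Satake isomorphism for the hyperspecial level of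
  `U(J_N)(F_v)`, Mínguez 2011, Thm. 4.1 — not in the tree); the reverse direction is
  `isWeakBaseChange_of_eventually_matching`;
* `UnitaryGroup.IsWeakBaseChange.of_isNearlyEquivalent`, `….isNearlyEquivalent` and
  `AutomorphicRepData.IsConjSelfDualAE.of_isNearlyEquivalent` — both conjuncts of the conclusion
  of `Mok2014_weakBaseChange` depend on the witness `P` only through its near-equivalence class
  (Jacquet–Shalika 1981, §4), and two weak base changes of one `π` are nearly equivalent
  (`isConjSelfDualAE_and_isWeakBaseChange_of_isNearlyEquivalent`).
* **The conjugate self-duality conjunct is automatic** (second part of the file; Mok, Lemma 2.2.1: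
  the image of `ξ_{χ_κ,*}` consists of conjugate self-dual parameters).  On the rendered predicate this
  is the symmetry `HasBaseChangeSatakeAt π (c • w) α ↔ HasBaseChangeSatakeAt π w α⁻¹`
  (`UnitaryGroup.hasBaseChangeSatakeAt_smul_iff`), proved from the defining relation of `U(J_N)`
  solved for the inverse, `(g⁻¹)_{ij} = c(g_{N-1-j,N-1-i})` (`adelicVal_inv_val_apply`), which gives
  upper-triangularity at `c • w` iff at `w`, diagonal orders `ord_{c w}(g_{ii}) = -ord_w(g_{N-1-i,N-1-i})`
  and equal Iwasawa sums for the reversed-inverted torus parameters (`heckeEigenvalue_smul_of_ne`;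
  Mínguez 2011, Thm. 4.1 on parameters).  Hence `IsWeakBaseChange P π → P.IsConjSelfDualAE c`
  (`UnitaryGroup.IsWeakBaseChange.isConjSelfDualAE`), and the named fact is EQUIVALENT to the bare
  existence of a weak base change (`Mok2014_weakBaseChange_iff_forall_exists_isWeakBaseChange`),
  i.e. to (i) + (ii) below (`Mok2014_weakBaseChange_iff_forall_eventually_unique_and_exists_matching`).

## What is NOT proved here (status of the discharge `Mok2014_weakBaseChange_holds`)

The existence half — an automorphic `P` on `GL_N(𝔸_E)` whose Satake parameters match `ξ_1(c(π))`
almost everywhere — is Mok's Prop. 4.3.4 ⇒ Cor. 4.3.8 ("the proof of corollary 4.3.8 from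
proposition 4.3.4 is the same as the proof of corollary 3.4.3 of [A1]"), proved by comparing the
stabilised trace formula of `U_{E/F}(N)` with the stabilised twisted trace formula of
`G̃_{E/F}(N) = Res_{E/F} GL_N ⋊ θ` (Mok §4.1–4.3 under Hypothesis 4.2.1, the stabilisation of the
twisted trace formula, Mœglin–Waldspurger 2016; [A1] = Arthur 2013, §3.4–3.5), by induction on `N`
with the `L²` spectral decomposition of `GL_N` (Mœglin–Waldspurger, Jacquet–Shalika).  None of these
objects (invariant or stable trace formulae, endoscopic transfer, fundamental lemmas, `L²_disc` of
`GL_N`) exists in the tree, and hypothesis (i) of `isWeakBaseChange_iff` (uniqueness of base-change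
Satake parameters of `π` almost everywhere) needs the Satake isomorphism for the hyperspecial subgroup
of `U(J_N)(F_v)`.  Exactly these two remain the open obligations of the named fact
(`Mok2014_weakBaseChange_iff_forall_eventually_unique_and_exists_matching`); this file isolates them.

## References

* C. P. Mok, *Endoscopic classification of representations of quasi-split unitary groups*,
  Mem. Amer. Math. Soc. 235 (2015), no. 1108; arXiv:1206.0882: §2.3, Prop. 4.3.4, Cor. 4.3.8 and
  the paragraph following it [Mok2014].
* D. Flath, *Decomposition of representations into tensor products*, Proc. Sympos. Pure Math. 33
  (1979), part 1, Thm. 3 [FlathCorvallis1979].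
* H. Jacquet, J. Shalika, *On Euler products and the classification of automorphic forms II*,
  Amer. J. Math. 103 (1981), §4 [JacquetShalika1981].
* A. Mínguez, *Unramified representations of unitary groups*, in: On the stabilization of the trace
  formula, Int. Press 2011, 389–410, Thm. 4.1 [Minguez2011].
* J. W. S. Cassels, A. Fröhlich (eds.), *Algebraic Number Theory* (1967), Ch. VII (J. Tate), §1.1
  [CasselsFrohlichANT1967].
-/

noncomputable section

open scoped Classical MatrixGroups Matrix
open Filter IsDedekindDomain NumberField

namespace Literature.NumberTheory.Automorphic

variable {F E : Type} [Field F] [NumberField F] [Field E] [NumberField E] [Algebra F E]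

/-! ## `GL_N` side: near-equivalence and conjugate self-duality almost everywhere -/

namespace AutomorphicRepData

variable {N : ℕ} {hcpt : isCompact_glFiniteIntegralLevel N E}
  {P P' : AutomorphicRepData (AutomorphyDatum.gl N E hcpt)}

/-- Nearly equivalent automorphic representation data of `GL_N(𝔸_E)` have, at almost every finite
place, the same Satake parameters — as predicates in the parameter (uniqueness of Satake
parameters, `hasSatakeParamAt_unique_holds`). Flath 1979, Thm. 3; Jacquet–Shalika 1981, §4.
[cite: FlathCorvallis1979, Thm. 3] -/
theorem IsNearlyEquivalent.eventually_forall_hasSatakeParamAt_iff (h : P.IsNearlyEquivalent P') :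
    ∀ᶠ w : HeightOneSpectrum (𝓞 E) in cofinite, ∀ α : Multiset ℂ,
      P.HasSatakeParamAt w α ↔ P'.HasSatakeParamAt w α := by
  filter_upwards [h] with w hw α
  obtain ⟨α₀, hP, hP'⟩ := hw
  constructor
  · intro hα
    rw [P.hasSatakeParamAt_unique_holds hα hP]
    exact hP'
  · intro hα
    rw [P'.hasSatakeParamAt_unique_holds hα hP']
    exact hP

omit [NumberField F] in
/-- **Conjugate self-duality a.e. is a property of the near-equivalence class.** If `P` is
conjugate self-dual almost everywhere on Satake parameters (`IsConjSelfDualAE`) and `P'` is nearly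
equivalent to `P`, then so is `P'`: the conjugate place `c • w` eventually leaves every finite set,
`w ↦ c • w` being injective. Mok, §2.2–2.3 (conjugate self-dual representations, on Satake
parameters); Flath 1979, Thm. 3. [cite: Mok2014, §2.2–§2.3] -/
theorem IsConjSelfDualAE.of_isNearlyEquivalent {c : E ≃ₐ[F] E} (h : P.IsConjSelfDualAE c)
    (hPP' : P.IsNearlyEquivalent P') : P'.IsConjSelfDualAE c := by
  have hc : Tendsto (fun w : HeightOneSpectrum (𝓞 E) => c • w) cofinite cofinite :=
    (MulAction.injective c).tendsto_cofinite
  have h₁ := hPP'.eventually_forall_hasSatakeParamAt_iff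
  have h₂ := hc.eventually h₁
  filter_upwards [h, h₁, h₂] with w hw h₁w h₂w α β hα hβ
  exact hw α β ((h₁w α).2 hα) ((h₂w β).2 hβ)

end AutomorphicRepData

/-! ## `U_{E/F}(N)` side: the `iff` form of weak base change, unpacked -/

namespace UnitaryGroup

variable {c : E ≃ₐ[F] E} {N : ℕ} {hcpt : isCompact_glFiniteIntegralLevel N E}
  {P P' : AutomorphicRepData (AutomorphyDatum.gl N E hcpt)} {π : UnitaryGroupAutomorphicRep F E c N hcpt}

/-- **Printed shape ⇒ vendored shape.** If at almost every finite place `w` of `E` the base-change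
Satake parameter of `π` is unique, and some base-change Satake parameter of `π` at `w` is a Satake
parameter of `P` at `w` (Mok's `c(P) = ξ_1(c(π))` outside a finite set of places), then `P` is a
weak base change of `π` in the `iff` form of the tree; the `GL_N`-side uniqueness used for the
converse implication at each place is Flath's theorem (`hasSatakeParamAt_unique_holds`).
Mok, Cor. 4.3.8 and the paragraph following it; Flath 1979, Thm. 3. [cite: Mok2014, Cor. 4.3.8] -/
theorem isWeakBaseChange_of_eventually_matching
    (hu : ∀ᶠ w : HeightOneSpectrum (𝓞 E) in cofinite, ∀ α β : Multiset ℂ,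
      HasBaseChangeSatakeAt F E c N hcpt π w α → HasBaseChangeSatakeAt F E c N hcpt π w β → α = β)
    (hm : ∀ᶠ w : HeightOneSpectrum (𝓞 E) in cofinite, ∃ α : Multiset ℂ,
      HasBaseChangeSatakeAt F E c N hcpt π w α ∧ P.HasSatakeParamAt w α) :
    IsWeakBaseChange F E c N hcpt P π := by
  filter_upwards [hu, hm] with w huw hmw α
  obtain ⟨α₀, hπ₀, hP₀⟩ := hmw
  constructor
  · intro hα
    rw [huw α α₀ hα hπ₀]
    exact hP₀
  · intro hα
    rw [P.hasSatakeParamAt_unique_holds hα hP₀]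
    exact hπ₀

/-- **Vendored shape ⇒ printed shape.** A weak base change `P` of `π` has, at almost every finite
place `w` of `E`, a Satake parameter which is a base-change Satake parameter of `π` at `w`
(automorphic representation data of `GL_N(𝔸_E)` are unramified almost everywhere,
`hasSatakeParamAt_cofinite_holds`). Mok, Cor. 4.3.8 and the paragraph following it; Flath 1979,
Thm. 3. [cite: Mok2014, Cor. 4.3.8] -/
theorem IsWeakBaseChange.eventually_matching (h : IsWeakBaseChange F E c N hcpt P π) :
    ∀ᶠ w : HeightOneSpectrum (𝓞 E) in cofinite, ∃ α : Multiset ℂ,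
      HasBaseChangeSatakeAt F E c N hcpt π w α ∧ P.HasSatakeParamAt w α := by
  filter_upwards [h, P.hasSatakeParamAt_cofinite_holds] with w hw hPw
  obtain ⟨α, hα⟩ := hPw
  exact ⟨α, (hw α).2 hα, hα⟩

/-- **A weakly base-changed `π` has unique base-change Satake parameters almost everywhere** (they
are the Satake parameters of `P`, unique by Flath's theorem, `hasSatakeParamAt_unique_holds`).
Flath 1979, Thm. 3. [cite: FlathCorvallis1979, Thm. 3] -/
theorem IsWeakBaseChange.eventually_unique (h : IsWeakBaseChange F E c N hcpt P π) :
    ∀ᶠ w : HeightOneSpectrum (𝓞 E) in cofinite, ∀ α β : Multiset ℂ,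
      HasBaseChangeSatakeAt F E c N hcpt π w α → HasBaseChangeSatakeAt F E c N hcpt π w β →
        α = β := by
  filter_upwards [h] with w hw α β hα hβ
  exact P.hasSatakeParamAt_unique_holds ((hw α).1 hα) ((hw β).1 hβ)

/-- **The tree's `iff` form of weak base change, unpacked**: `P` is a weak base change of `π` iff
the base-change Satake parameters of `π` are unique almost everywhere and match Satake parameters
of `P` almost everywhere (the printed "`c(P) = ξ_1(c(π))` outside a finite set").  This isolates what
a discharge of `Mok2014_weakBaseChange` must supply on top of Mok's Cor. 4.3.8: the `U(N)`-side
uniqueness (i). Mok, §2.3 and Cor. 4.3.8; Flath 1979, Thm. 3. [cite: Mok2014, Cor. 4.3.8] -/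
theorem isWeakBaseChange_iff :
    IsWeakBaseChange F E c N hcpt P π ↔
      (∀ᶠ w : HeightOneSpectrum (𝓞 E) in cofinite, ∀ α β : Multiset ℂ,
          HasBaseChangeSatakeAt F E c N hcpt π w α → HasBaseChangeSatakeAt F E c N hcpt π w β →
            α = β) ∧
        ∀ᶠ w : HeightOneSpectrum (𝓞 E) in cofinite, ∃ α : Multiset ℂ,
          HasBaseChangeSatakeAt F E c N hcpt π w α ∧ P.HasSatakeParamAt w α :=
  ⟨fun h => ⟨h.eventually_unique, h.eventually_matching⟩,
    fun h => isWeakBaseChange_of_eventually_matching h.1 h.2⟩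

/-- **Weak base change is a property of the near-equivalence class of `P`**: if `P` is a weak base
change of `π` and `P'` is nearly equivalent to `P`, then `P'` is a weak base change of `π`.
Mok, §2.3 (`c(ψ^N)` as a Hecke eigenfamily up to finitely many places); Jacquet–Shalika 1981, §4.
[cite: Mok2014, §2.3] -/
theorem IsWeakBaseChange.of_isNearlyEquivalent (h : IsWeakBaseChange F E c N hcpt P π)
    (hPP' : P.IsNearlyEquivalent P') : IsWeakBaseChange F E c N hcpt P' π := by
  filter_upwards [h, hPP'.eventually_forall_hasSatakeParamAt_iff] with w hw hw' α
  exact (hw α).trans (hw' α)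

/-- **Two weak base changes of the same `π` are nearly equivalent** (so the weak base change is
unique up to near-equivalence; for isobaric `P`, `P'` this is `P ≅ P'` by Jacquet–Shalika 1981,
Thm. 4.4, not restated here). [cite: JacquetShalika1981, §4] -/
theorem IsWeakBaseChange.isNearlyEquivalent (h : IsWeakBaseChange F E c N hcpt P π)
    (h' : IsWeakBaseChange F E c N hcpt P' π) : P.IsNearlyEquivalent P' := by
  filter_upwards [h, h', P.hasSatakeParamAt_cofinite_holds] with w hw hw' hPw
  obtain ⟨α, hα⟩ := hPw
  exact ⟨α, hα, (hw' α).1 ((hw α).2 hα)⟩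

/-- **The conclusion of `Mok2014_weakBaseChange` for `π` is invariant under near-equivalence of the
witness**: if `P` is conjugate self-dual a.e. and a weak base change of `π`, so is every `P'` nearly
equivalent to `P` (e.g. another realisation `W / W'` of Mok's `π_{ψ^N}`, §2.3).
[cite: Mok2014, §2.3 and Cor. 4.3.8] -/
theorem isConjSelfDualAE_and_isWeakBaseChange_of_isNearlyEquivalent
    (h : P.IsConjSelfDualAE c ∧ IsWeakBaseChange F E c N hcpt P π) (hPP' : P.IsNearlyEquivalent P') :
    P'.IsConjSelfDualAE c ∧ IsWeakBaseChange F E c N hcpt P' π :=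
  ⟨h.1.of_isNearlyEquivalent hPP', h.2.of_isNearlyEquivalent hPP'⟩

end UnitaryGroup

/-! ## Conjugation symmetry of base-change Satake parameters (`w ↦ c • w`, `α ↦ α⁻¹`) and the
automatic conjugate self-duality of a weak base change

Mok, Lemma 2.2.1 (arXiv p. 8): "The image of `ξ_{χ_κ,*} : Φ(U_{E/F}(N)) → Φ(G_{E/F}(N)) ≅ Φ(GL_N(E))`
is given by the set of parameters in `Φ(GL_N(E))` that are conjugate self-dual with parity `η`" — in
particular a (weak, standard) base change is conjugate self-dual.  On unramified Satake parameters,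
which is all the tree's `IsWeakBaseChange` / `IsConjSelfDualAE` see, this is the following symmetry
of the rendered predicate `HasBaseChangeSatakeAt`: for `g ∈ U(J_N)(𝔸_F)` the defining relation
`ᵗ(c g) J_N g = J_N` with the anti-diagonal involution `J_N` reads `(g⁻¹)_{ij} = c (g_{N-1-j, N-1-i})`
(`adelicVal_inv_val_apply`), so the `c • w`-component of `g` is `J_N ᵗ(c_w (g_w)⁻¹) J_N`; hence `g` is
upper triangular at `c • w` iff it is at `w`, with diagonal orders `ord_{c w}(g_{ii}) = -ord_w(g_{N-1-i,N-1-i})`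
(`diagOrd_smul_of_isUpperTriangularAt`), and the Iwasawa sum defining the unramified Hecke
eigenvalue at `c • w` for the torus parameters `β*_i = β_{N-1-i}⁻¹` equals the one at `w` for `β`
(`heckeEigenvalue_smul_of_ne`; at a `c`-fixed `w` nothing is to be done, the base-change constraint
`β_{N-1-i} = β_i⁻¹` making the multiset inverse-closed).  Consequently
`HasBaseChangeSatakeAt π (c • w) α ↔ HasBaseChangeSatakeAt π w α⁻¹` (`hasBaseChangeSatakeAt_smul_iff`)
and **every weak base change `P` of `π` is conjugate self-dual almost everywhere**
(`IsWeakBaseChange.isConjSelfDualAE`, with Flath's uniqueness on the `GL_N` side): the conjunct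
`P.IsConjSelfDualAE c` of `Mok2014_weakBaseChange` is automatic, and the named fact is equivalent to
the bare existence of a weak base change (`Mok2014_weakBaseChange_iff_forall_exists_isWeakBaseChange`),
i.e. to the `U(N)`-side uniqueness (i) together with the printed matching (ii)
(`Mok2014_weakBaseChange_iff_forall_eventually_unique_and_exists_matching`). -/

namespace StdForm

variable {N : ℕ}

/-- Entries of Mok's anti-diagonal form over any ring: `(J_N)_{ij} = δ_{j, N-1-i}` (private copy of the
accepted `StdForm.antidiagonal_over_apply` of `UnitaryGroupGlobalGenericity`, not imported here). [cite: Mok2014, §1 Notation p. 5] -/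
private theorem antidiag_apply (R : Type*) [Ring R] (i j : Fin N) :
    (antidiagonal N).over R i j = if j = i.rev then 1 else 0 := by
  simp [StdForm.over, Matrix.map_apply]

/-- Entries of Mok's anti-diagonal form, symmetric indexing: `(J_N)_{ij} = δ_{i, N-1-j}`. [cite: Mok2014, §1 Notation p. 5] -/
private theorem antidiag_apply' (R : Type*) [Ring R] (i j : Fin N) :
    (antidiagonal N).over R i j = if i = j.rev then 1 else 0 := by
  rw [antidiag_apply]
  congr 1
  exact propext ⟨fun h => by rw [h, Fin.rev_rev], fun h => by rw [h, Fin.rev_rev]⟩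

/-- Left multiplication by `J_N` reverses the rows: `(J_N X)_{ik} = X_{N-1-i, k}`. [folklore] -/
private theorem antidiag_mul_apply {R : Type*} [Ring R] (X : Matrix (Fin N) (Fin N) R) (i k : Fin N) :
    ((antidiagonal N).over R * X) i k = X i.rev k := by
  simp [Matrix.mul_apply, antidiag_apply R]

/-- Right multiplication by `J_N` reverses the columns: `(X J_N)_{ij} = X_{i, N-1-j}`. [folklore] -/
private theorem mul_antidiag_apply {R : Type*} [Ring R] (X : Matrix (Fin N) (Fin N) R) (i j : Fin N) :
    (X * (antidiagonal N).over R) i j = X i j.rev := by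
  simp [Matrix.mul_apply, antidiag_apply' R]

end StdForm

section Helpers

/-- **Diagonal of the inverse of an upper triangular invertible matrix** over a field:
`(u⁻¹)_{ii} u_{ii} = 1` (the inverse is upper triangular, Mathlib
`Matrix.blockTriangular_inv_of_blockTriangular`, and `(u⁻¹ u)_{ii} = (u⁻¹)_{ii} u_{ii}`). [folklore] -/
theorem GeneralLinearGroup.inv_apply_mul_apply_eq_one_of_blockTriangular {K : Type*} [Field K] {n : ℕ}
    (u : GL (Fin n) K) (hu : u.val.BlockTriangular id) (i : Fin n) :
    (u⁻¹).val i i * u.val i i = 1 := by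
  have hu' : (u.val)⁻¹.BlockTriangular id := Matrix.blockTriangular_inv_of_blockTriangular hu
  have h1 : ((u⁻¹).val * u.val) i i = 1 := by
    rw [← Units.val_mul, inv_mul_cancel, Units.val_one, Matrix.one_apply_eq]
  rw [Matrix.mul_apply] at h1
  rw [← h1, eq_comm]
  refine Finset.sum_eq_single i (fun k _ hki => ?_) (fun h => absurd (Finset.mem_univ i) h)
  rcases lt_or_gt_of_ne hki with hk | hk
  · rw [Matrix.coe_units_inv, hu' hk, zero_mul]
  · rw [hu hk, mul_zero]

/-- The inverse of an upper triangular invertible matrix over a field is upper triangular (Mathlib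
`Matrix.blockTriangular_inv_of_blockTriangular`, restated for `GL_n`). [folklore] -/
theorem GeneralLinearGroup.blockTriangular_inv {K : Type*} [Field K] {n : ℕ}
    (u : GL (Fin n) K) (hu : u.val.BlockTriangular id) : (u⁻¹).val.BlockTriangular id := by
  rw [Matrix.coe_units_inv]
  exact Matrix.blockTriangular_inv_of_blockTriangular hu

/-- Transport of `if h : ∃ x, p x then f h.choose else d` along a pointwise equivalent predicate `q`
and functions agreeing on `{p}` (the two `Exists.choose` then pick the same witness). [folklore] -/
theorem dite_exists_choose_congr {ι M : Type*} {p q : ι → Prop} [Decidable (∃ x, p x)]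
    [Decidable (∃ x, q x)] {f g : ι → M} {d : M}
    (hpq : ∀ x, p x ↔ q x) (hfg : ∀ x, p x → f x = g x) :
    (if h : ∃ x, p x then f h.choose else d) = (if h : ∃ x, q x then g h.choose else d) := by
  obtain rfl : p = q := funext fun x => propext (hpq x)
  by_cases h : ∃ x, p x
  · rw [dif_pos h, dif_pos h]; exact hfg _ h.choose_spec
  · rw [dif_neg h, dif_neg h]

end Helpers

namespace UnitaryGroup

variable {c : E ≃ₐ[F] E} {N : ℕ}

variable (c) in
/-- **The defining relation of `U(J_N)` solved for the inverse**: for `g ∈ U_{E/F}(N)(𝔸_F)`,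
`(g⁻¹)_{ij} = (c ⊗ 1)(g_{N-1-j, N-1-i})`, i.e. `g⁻¹ = J_N ᵗ((c ⊗ 1) g) J_N` (from `ᵗ(c g) J_N g = J_N` and
`J_N² = 1`). Mok, §1 Notation (p. 5). [cite: Mok2014, §1 Notation p. 5] -/
theorem adelicVal_inv_val_apply (g : (quasiSplit F E c N).Adelic) (i j : Fin N) :
    (adelicVal F E c N _ g⁻¹).val i j = c • ((adelicVal F E c N _ g).val j.rev i.rev) := by
  have hg : (adelicVal F E c N _ g) ∈ adelic F E c N ((StdForm.antidiagonal N).over E) :=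
    (g : adelic F E c N _).2
  rw [adelic, adelicForm_over, mem_unitaryGroupOfForm_iff] at hg
  set u : GL (Fin N) (AdeleRing (𝓞 E) E) := adelicVal F E c N _ g with hu
  set J := (StdForm.antidiagonal N).over (AdeleRing (𝓞 E) E) with hJ
  have hinv : (u⁻¹).val = J * (u.val.map (conjAdele F E c))ᵀ * J := by
    apply Units.inv_eq_of_mul_eq_one_left
    calc J * (u.val.map (conjAdele F E c))ᵀ * J * u.val
        = J * ((u.val.map (conjAdele F E c))ᵀ * J * u.val) := by
          simp only [Matrix.mul_assoc]
      _ = 1 := by rw [hg, hJ, StdForm.over_mul_over]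
  rw [map_inv, hinv, StdForm.mul_antidiag_apply, StdForm.antidiag_mul_apply,
    Matrix.transpose_apply, Matrix.map_apply, conjAdele_apply]

/-- Finite components of the previous identity: the `c • w`-component of `(g⁻¹)_{ij}` is the transport
`c_w : E_w → E_{c w}` of the `w`-component of `g_{N-1-j, N-1-i}` (`(c • x)_{c w} = c_w(x_w)`,
`FiniteAdeleRing.smul_apply_smul`). Cassels–Fröhlich, Ch. VII §1.1. [cite: CasselsFrohlichANT1967, Ch. VII §1.1] -/
theorem adelicVal_inv_val_apply_snd_smul (g : (quasiSplit F E c N).Adelic) (i j : Fin N)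
    (w : HeightOneSpectrum (𝓞 E)) :
    ((adelicVal F E c N _ g⁻¹).val i j).2 (c • w) =
      galAdicCompletionMap c rfl (((adelicVal F E c N _ g).val j.rev i.rev).2 w) := by
  rw [adelicVal_inv_val_apply c, AdeleRing.smul_snd, FiniteAdeleRing.smul_apply_smul E c]

/-- "Supported over the place `v` below `w`" depends only on `{w, c • w}`: for an involution `c` it is the
same condition at `w` and at `c • w`. [folklore] -/
theorem isSupportedAt_smul_iff (hc : c * c = 1) {w : HeightOneSpectrum (𝓞 E)}
    {t : (quasiSplit F E c N).Adelic} :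
    IsSupportedAt F E c N (c • w) t ↔ IsSupportedAt F E c N w t := by
  simp only [IsSupportedAt, HeightOneSpectrum.smul_smul_of_mul_self_eq_one hc]
  exact and_congr_right fun _ => forall_congr' fun u =>
    ⟨fun h h1 h2 => h h2 h1, fun h h1 h2 => h h2 h1⟩

/-- `t⁻¹` is supported over `v` iff `t` is. [folklore] -/
theorem isSupportedAt_inv_iff {w : HeightOneSpectrum (𝓞 E)} {t : (quasiSplit F E c N).Adelic} :
    IsSupportedAt F E c N w t⁻¹ ↔ IsSupportedAt F E c N w t := by
  simp only [IsSupportedAt, map_inv, inv_eq_one]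

/-- `g⁻¹` is upper triangular at `c • w` iff `g` is upper triangular at `w` (by
`adelicVal_inv_val_apply_snd_smul`: reversing rows and columns and transposing preserves upper
triangularity). [folklore] -/
theorem isUpperTriangularAt_smul_inv_iff {w : HeightOneSpectrum (𝓞 E)} (g : (quasiSplit F E c N).Adelic) :
    IsUpperTriangularAt F E c N (c • w) g⁻¹ ↔ IsUpperTriangularAt F E c N w g := by
  simp only [IsUpperTriangularAt, adelicVal_inv_val_apply_snd_smul,
    map_eq_zero_iff _ (galAdicCompletionMap c _).injective]
  constructor
  · intro h i j hij
    simpa only [Fin.rev_rev] using h j.rev i.rev (Fin.rev_lt_rev.mpr hij)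
  · intro h i j hij
    exact h j.rev i.rev (Fin.rev_lt_rev.mpr hij)

/-- Diagonal orders of `g⁻¹` at `c • w` are those of `g` at `w`, reversed:
`ord_{c w}((g⁻¹)_{ii}) = ord_w(g_{N-1-i, N-1-i})` (`c_w` preserves valuations,
`valued_galAdicCompletionMap`). [folklore] -/
theorem diagOrd_smul_inv (w : HeightOneSpectrum (𝓞 E)) (g : (quasiSplit F E c N).Adelic) (i : Fin N) :
    diagOrd F E c N (c • w) g⁻¹ i = diagOrd F E c N w g i.rev := by
  simp only [diagOrd, adelicVal_inv_val_apply_snd_smul, valued_galAdicCompletionMap]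

/-- An element upper triangular at `w` has upper triangular `w`-component `g_w ∈ GL_N(E_w)` (Mathlib's
`Matrix.BlockTriangular` for `id`; definitional). [folklore] -/
theorem IsUpperTriangularAt.blockTriangular {w : HeightOneSpectrum (𝓞 E)} {g : (quasiSplit F E c N).Adelic}
    (h : IsUpperTriangularAt F E c N w g) :
    (Matrix.GeneralLinearGroup.map (AdelicGroupData.adeleEval E w) (adelicVal F E c N _ g)).val.BlockTriangular
      id :=
  fun i j hij => h i j hij

/-- The inverse of an element upper triangular at `w` is upper triangular at `w` (the Borel subgroup of
`GL_N(E_w)` is a group). [folklore] -/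
theorem IsUpperTriangularAt.inv {w : HeightOneSpectrum (𝓞 E)} {g : (quasiSplit F E c N).Adelic}
    (h : IsUpperTriangularAt F E c N w g) : IsUpperTriangularAt F E c N w g⁻¹ := by
  have hB := GeneralLinearGroup.blockTriangular_inv _ h.blockTriangular
  rw [← map_inv, ← map_inv] at hB
  exact fun i j hij => hB hij

/-- `g⁻¹` is upper triangular at `w` iff `g` is. [folklore] -/
theorem isUpperTriangularAt_inv_iff {w : HeightOneSpectrum (𝓞 E)} {g : (quasiSplit F E c N).Adelic} :
    IsUpperTriangularAt F E c N w g⁻¹ ↔ IsUpperTriangularAt F E c N w g :=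
  ⟨fun h => by simpa only [inv_inv] using h.inv, fun h => h.inv⟩

/-- **`g ∈ U(J_N)(𝔸_F)` is upper triangular at `c • w` iff it is upper triangular at `w`** (its
`c • w`-component is `J_N ᵗ(c_w (g_w)⁻¹) J_N`). [folklore] -/
theorem isUpperTriangularAt_smul_iff {w : HeightOneSpectrum (𝓞 E)} {g : (quasiSplit F E c N).Adelic} :
    IsUpperTriangularAt F E c N (c • w) g ↔ IsUpperTriangularAt F E c N w g := by
  rw [← isUpperTriangularAt_inv_iff (w := c • w), isUpperTriangularAt_smul_inv_iff]

/-- For `g` upper triangular at `w` the diagonal orders of `g⁻¹` at `w` are the negatives of those of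
`g` (`((g_w)⁻¹)_{ii} = (g_{w,ii})⁻¹`). [folklore] -/
theorem IsUpperTriangularAt.diagOrd_inv {w : HeightOneSpectrum (𝓞 E)} {g : (quasiSplit F E c N).Adelic}
    (h : IsUpperTriangularAt F E c N w g) (i : Fin N) :
    diagOrd F E c N w g⁻¹ i = -diagOrd F E c N w g i := by
  set gw := Matrix.GeneralLinearGroup.map (AdelicGroupData.adeleEval E w) (adelicVal F E c N _ g) with hgw
  have hd := GeneralLinearGroup.inv_apply_mul_apply_eq_one_of_blockTriangular gw h.blockTriangular i
  have e1 : ((adelicVal F E c N _ g⁻¹).val i i).2 w = (gw⁻¹).val i i := by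
    rw [hgw, ← map_inv, ← map_inv]; rfl
  have e2 : ((adelicVal F E c N _ g).val i i).2 w = gw.val i i := rfl
  simp only [diagOrd, e1, e2]
  rw [eq_inv_of_mul_eq_one_left hd, map_inv₀, WithZero.log_inv, neg_neg]

/-- **Diagonal orders at the conjugate place**: for `g ∈ U(J_N)(𝔸_F)` upper triangular at `w`,
`ord_{c w}(g_{ii}) = -ord_w(g_{N-1-i, N-1-i})` — the torus coordinate `i` at `c • w` is the inverse
of the coordinate `N-1-i` at `w` (Mok, §2.1: `ξ_1` and the identification `E_v = E_w × E_{c w}` at a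
split place). [cite: Mok2014, §2.1] -/
theorem diagOrd_smul_of_isUpperTriangularAt {w : HeightOneSpectrum (𝓞 E)} {g : (quasiSplit F E c N).Adelic}
    (h : IsUpperTriangularAt F E c N w g) (i : Fin N) :
    diagOrd F E c N (c • w) g i = -diagOrd F E c N w g i.rev := by
  have := diagOrd_smul_inv (c := c) w g⁻¹ i
  rw [inv_inv] at this
  rw [this, h.diagOrd_inv]

omit [NumberField F] [NumberField E] in
/-- At a place `w ≠ c • w` (split `v`) all `N` torus coordinates are free. [folklore] -/
theorem torusIndices_eq_univ_of_ne {w : HeightOneSpectrum (𝓞 E)} (hw : c • w ≠ w) :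
    torusIndices F E c N w = Finset.univ := by
  ext i; simp [torusIndices, hw]

variable (F) in
omit [NumberField F] in
/-- Conjugate places have the same residue cardinality, `q_{c w} = q_w`
(`HeightOneSpectrum.absNorm_algEquiv_smul`). [folklore] -/
theorem residueCard_smul (w : HeightOneSpectrum (𝓞 E)) : (c • w).residueCard = w.residueCard :=
  HeightOneSpectrum.absNorm_algEquiv_smul F c w

/-- **The Iwasawa character at the conjugate place.** At a split place (`c • w ≠ w`), for `g ∈ U(J_N)(𝔸_F)`
upper triangular at `w` and the reversed-inverted torus parameters `β*_i = β_{N-1-i}⁻¹`,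
`(χ_{β*} δ_B^{1/2})_{c w}(g) = (χ_β δ_B^{1/2})_w(g)`: by `diagOrd_smul_of_isUpperTriangularAt` the
factor `i` at `c • w` is the factor `N-1-i` at `w` (`(β_{N-1-i}⁻¹)^{-d} = β_{N-1-i}^d` and
`N-1-2i = -(N-1-2(N-1-i))`), and `q_{c w} = q_w`. This is the unramified case of Mok, Lemma 2.2.1, for
the standard base change at a split place (`ξ_1 : g ↦ (g, ᵗg⁻¹)`, §2.1). [cite: Mok2014, §2.1 and Lemma 2.2.1] -/
theorem iwasawaChar_smul_of_ne (hc : c * c = 1) {w : HeightOneSpectrum (𝓞 E)} (hw : c • w ≠ w)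
    (β : Fin N → ℂ) {g : (quasiSplit F E c N).Adelic} (hg : IsUpperTriangularAt F E c N w g) :
    iwasawaChar F E c N (c • w) (fun i => (β i.rev)⁻¹) g = iwasawaChar F E c N w β g := by
  have hcw : c • c • w = w := HeightOneSpectrum.smul_smul_of_mul_self_eq_one hc w
  have hw' : c • c • w ≠ c • w := by rw [hcw]; exact Ne.symm hw
  unfold iwasawaChar
  rw [torusIndices_eq_univ_of_ne hw', torusIndices_eq_univ_of_ne hw, residueCard_smul F]
  simp only [diagOrd_smul_of_isUpperTriangularAt hg]
  refine Fintype.prod_equiv Fin.revPerm _ _ fun i => ?_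
  simp only [Fin.revPerm_apply, inv_zpow', neg_neg]
  have hi : (((i.rev : Fin N) : ℕ) : ℤ) = N - 1 - (i : ℕ) := by
    rw [Fin.val_rev]; omega
  congr 2
  rw [hi]; ring

/-- **The Iwasawa value of a coset at the conjugate place** (split `v`): the representatives admissible at
`c • w` are exactly those admissible at `w` (`isSupportedAt_smul_iff`, `isUpperTriangularAt_smul_iff`), on
which the Iwasawa characters agree (`iwasawaChar_smul_of_ne`); the `Exists.choose` is transported by
`dite_exists_choose_congr`. [folklore] -/
theorem iwasawaValue_smul_of_ne (hc : c * c = 1) {w : HeightOneSpectrum (𝓞 E)} (hw : c • w ≠ w)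
    (β : Fin N → ℂ) (K : Subgroup (quasiSplit F E c N).Adelic) (y : (quasiSplit F E c N).Adelic ⧸ K) :
    iwasawaValue F E c N (c • w) (fun i => (β i.rev)⁻¹) K y = iwasawaValue F E c N w β K y := by
  unfold iwasawaValue
  exact dite_exists_choose_congr
    (fun b => by rw [isSupportedAt_smul_iff hc, isUpperTriangularAt_smul_iff])
    (fun b hb => iwasawaChar_smul_of_ne hc hw β (isUpperTriangularAt_smul_iff.1 hb.2.1))

/-- **Unramified Hecke eigenvalues at the conjugate place** (split `v`): the Satake transform of `[K t K]`
evaluated at `χ_{β*}` with respect to `c • w`, `β*_i = β_{N-1-i}⁻¹`, equals its value at `χ_β` with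
respect to `w` — the unramified representation of `U(F_v) ≅ GL_N(E_w) ≅ GL_N(E_{c w})` with `E_w`-Satake
parameter `{β_i}` has `E_{c w}`-Satake parameter `{β_i⁻¹}` (Mok, §2.1, `ξ_1 : g ↦ (g, ᵗg⁻¹)`; Mínguez 2011,
Thm. 4.1). [cite: Minguez2011, Thm. 4.1] -/
theorem heckeEigenvalue_smul_of_ne (hc : c * c = 1) {w : HeightOneSpectrum (𝓞 E)} (hw : c • w ≠ w)
    (β : Fin N → ℂ) (K : Subgroup (quasiSplit F E c N).Adelic) (t : (quasiSplit F E c N).Adelic) :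
    heckeEigenvalue F E c N (c • w) (fun i => (β i.rev)⁻¹) K t = heckeEigenvalue F E c N w β K t := by
  unfold heckeEigenvalue
  exact finsum_congr fun y => finsum_congr fun _ => iwasawaValue_smul_of_ne hc hw β K y

omit [NumberField F] [NumberField E] in
/-- Reindexing a family along `i ↦ N-1-i` does not change the multiset of its values. [folklore] -/
theorem univ_val_map_comp_rev {M : Type*} (f : Fin N → M) :
    (Finset.univ : Finset (Fin N)).val.map (fun i => f i.rev) = Finset.univ.val.map f := by
  conv_rhs => rw [← Multiset.map_univ_val_equiv Fin.revPerm, Multiset.map_map]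
  simp only [Function.comp_def, Fin.revPerm_apply]

variable {hcpt : isCompact_glFiniteIntegralLevel N E}

/-- **Base-change Satake parameters at conjugate places are mutually inverse.** If `π` has base-change
Satake parameter `α` at `w`, then it has base-change Satake parameter `α⁻¹ = {α_i⁻¹}` at `c • w`
(`c` an involution): at a `c`-fixed `w` the base-change constraint `β_{N-1-i} = β_i⁻¹` (middle `1`) makes
`α` inverse-closed; at `w ≠ c • w` the same level, the same spherical form and the reversed-inverted torus
parameters `β*` witness it (`heckeEigenvalue_smul_of_ne`, `isSupportedAt_smul_iff`).  This is the
unramified content of Mok, Lemma 2.2.1 (arXiv p. 8: the image of `ξ_{χ_κ,*}` consists of conjugate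
self-dual parameters) for the standard base change `ξ_1`; Mínguez 2011, Thm. 4.1.
[cite: Mok2014, Lemma 2.2.1 (arXiv p. 8)] -/
theorem HasBaseChangeSatakeAt.smul (hc : c * c = 1) {π : AutomorphicRepData (quasiSplitDatum F E c N hcpt)}
    {w : HeightOneSpectrum (𝓞 E)} {α : Multiset ℂ} (h : HasBaseChangeSatakeAt F E c N hcpt π w α) :
    HasBaseChangeSatakeAt F E c N hcpt π (c • w) (α.map (·⁻¹)) := by
  obtain ⟨𝔫, β, h𝔫, hw𝔫, hcw𝔫, hβ, rfl, φ, hφW, hφW', hfix, heig⟩ := h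
  have hcw : c • c • w = w := HeightOneSpectrum.smul_smul_of_mul_self_eq_one hc w
  by_cases hw : c • w = w
  · rw [hw]
    refine ⟨𝔫, β, h𝔫, hw𝔫, hw ▸ hcw𝔫, hβ, ?_, φ, hφW, hφW', hfix, heig⟩
    rw [Multiset.map_map, ← univ_val_map_comp_rev β]
    refine Multiset.map_congr rfl fun i _ => ?_
    exact ((hβ.2 hw i).1).symm
  · refine ⟨𝔫, fun i => (β i.rev)⁻¹, h𝔫, hcw𝔫, by rwa [hcw], ?_, ?_, φ, hφW, hφW', hfix, ?_⟩
    · exact ⟨fun i => inv_ne_zero (hβ.1 _), fun h' => absurd (hcw.symm.trans h').symm hw⟩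
    · rw [Multiset.map_map]
      exact (univ_val_map_comp_rev ((fun x => x⁻¹) ∘ β)).symm
    · intro t ht
      rw [heckeEigenvalue_smul_of_ne hc hw]
      exact heig t ((isSupportedAt_smul_iff hc).1 ht)

/-- **Conjugation symmetry of base-change Satake parameters**: `π` has base-change Satake parameter `α`
at `c • w` iff it has base-change Satake parameter `α⁻¹` at `w` (`HasBaseChangeSatakeAt.smul` twice,
`c² = 1`, `(α⁻¹)⁻¹ = α`). [cite: Mok2014, Lemma 2.2.1 (arXiv p. 8)] -/
theorem hasBaseChangeSatakeAt_smul_iff (hc : c * c = 1)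
    {π : AutomorphicRepData (quasiSplitDatum F E c N hcpt)} {w : HeightOneSpectrum (𝓞 E)} {α : Multiset ℂ} :
    HasBaseChangeSatakeAt F E c N hcpt π (c • w) α ↔
      HasBaseChangeSatakeAt F E c N hcpt π w (α.map (·⁻¹)) := by
  constructor
  · intro h
    simpa only [HeightOneSpectrum.smul_smul_of_mul_self_eq_one hc] using h.smul hc
  · intro h
    simpa only [Multiset.map_map, Function.comp_def, inv_inv, Multiset.map_id'] using h.smul hc

/-- `π` is unramified at `c • w` iff it is unramified at `w` (in the sense of `IsUnramifiedAt`: some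
base-change Satake parameter exists). [folklore] -/
theorem isUnramifiedAt_smul_iff (hc : c * c = 1) {π : AutomorphicRepData (quasiSplitDatum F E c N hcpt)}
    {w : HeightOneSpectrum (𝓞 E)} :
    IsUnramifiedAt F E c N hcpt π (c • w) ↔ IsUnramifiedAt F E c N hcpt π w :=
  ⟨fun ⟨_, h⟩ => ⟨_, (hasBaseChangeSatakeAt_smul_iff hc).1 h⟩, fun ⟨_, h⟩ => ⟨_, h.smul hc⟩⟩

/-- **At a `c`-fixed place a base-change Satake parameter is inverse-closed**, `α⁻¹ = α` (the
base-change constraint `β_{N-1-i} = β_i⁻¹`, middle parameter `1`: the `GL_N(E_w)`-parameter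
`{β_i} ∪ {1} ∪ {β_i⁻¹}` of Mínguez 2011, Thm. 4.1). [cite: Minguez2011, Thm. 4.1] -/
theorem HasBaseChangeSatakeAt.map_inv_of_smul_eq {π : AutomorphicRepData (quasiSplitDatum F E c N hcpt)}
    {w : HeightOneSpectrum (𝓞 E)} (hw : c • w = w) {α : Multiset ℂ}
    (h : HasBaseChangeSatakeAt F E c N hcpt π w α) : α.map (·⁻¹) = α := by
  obtain ⟨𝔫, β, -, -, -, hβ, rfl, -⟩ := h
  rw [Multiset.map_map, ← univ_val_map_comp_rev β]
  exact Multiset.map_congr rfl fun i _ => ((hβ.2 hw i).1).symm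

variable {P : AutomorphicRepData (AutomorphyDatum.gl N E hcpt)} {π : UnitaryGroupAutomorphicRep F E c N hcpt}

/-- **A weak base change is conjugate self-dual almost everywhere.** If `P` is a weak base change of `π`
(for an involution `c`, e.g. the non-trivial automorphism of a quadratic `E/F`), then `P` is conjugate
self-dual almost everywhere on Satake parameters: at almost every `w` (with `c • w` also outside the
exceptional set, `w ↦ c • w` being injective) a Satake parameter `α` of `P` at `w` is a base-change
parameter of `π` at `w`, so `α⁻¹` is one at `c • w` (`HasBaseChangeSatakeAt.smul`), hence a Satake
parameter of `P` at `c • w`, and Satake parameters of `P` are unique (Flath 1979, Thm. 3,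
`hasSatakeParamAt_unique_holds`).  Printed: Mok, Lemma 2.2.1 (the image of `ξ_{χ_κ,*}` consists of
conjugate self-dual parameters) with §2.3 (`Ψ̃(N)`: the parameters `ψ^N` of Cor. 4.3.8 are conjugate
self-dual). Consequently the conjunct `IsConjSelfDualAE` of `Mok2014_weakBaseChange` is automatic.
[cite: Mok2014, Lemma 2.2.1 (arXiv p. 8) and §2.3] -/
theorem IsWeakBaseChange.isConjSelfDualAE (hc : c * c = 1) (h : IsWeakBaseChange F E c N hcpt P π) :
    P.IsConjSelfDualAE c := by
  have hc' : Tendsto (fun w : HeightOneSpectrum (𝓞 E) => c • w) cofinite cofinite :=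
    (MulAction.injective c).tendsto_cofinite
  filter_upwards [h, hc'.eventually h] with w hw hcw α β hα hβ
  exact P.hasSatakeParamAt_unique_holds hβ ((hcw _).1 (((hw α).2 hα).smul hc))

end UnitaryGroup

/-! ## What the named fact reduces to -/

/-- **`Mok2014_weakBaseChange` is equivalent to the bare existence of a weak base change**: the
conjugate self-duality conjunct is automatic (`IsWeakBaseChange.isConjSelfDualAE`, `c² = 1` for the
non-trivial automorphism of a quadratic extension, `AlgEquiv.mul_self_eq_one_of_finrank_eq_two`).
Mok, Cor. 4.3.8 and the paragraph following it, with Lemma 2.2.1. [cite: Mok2014, Cor. 4.3.8 and Lemma 2.2.1] -/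
theorem Mok2014_weakBaseChange_iff_forall_exists_isWeakBaseChange :
    Mok2014_weakBaseChange ↔
      ∀ (F E : Type) [Field F] [NumberField F] [Field E] [NumberField E] [Algebra F E] (c : E ≃ₐ[F] E),
        Module.finrank F E = 2 → c ≠ 1 →
        ∀ (N : ℕ) (hcpt : isCompact_glFiniteIntegralLevel N E)
          (π : UnitaryGroup.CuspidalAutomorphicRepData F E c N hcpt), 0 < N →
          ∃ P : AutomorphicRepData (AutomorphyDatum.gl N E hcpt),
            UnitaryGroup.IsWeakBaseChange F E c N hcpt P π.1 := by
  constructor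
  · intro h F E _ _ _ _ _ c h2 hc N hcpt π hN
    obtain ⟨P, -, hP⟩ := h F E c h2 hc N hcpt π hN
    exact ⟨P, hP⟩
  · intro h F E _ _ _ _ _ c h2 hc N hcpt π hN
    obtain ⟨P, hP⟩ := h F E c h2 hc N hcpt π hN
    exact ⟨P, hP.isConjSelfDualAE (AlgEquiv.mul_self_eq_one_of_finrank_eq_two h2 c), hP⟩

/-- **`Mok2014_weakBaseChange` unpacked into its two remaining obligations**: it holds iff for every
cuspidal `π` of `U_{E/F}(N)` (i) the base-change Satake parameters of `π` are unique at almost every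
place (the Satake isomorphism for the hyperspecial subgroup of `U(J_N)(F_v)` with the scalar action of the
unramified Hecke algebra on `π = W/W'`, Mínguez 2011, Thm. 4.1 with Flath 1979, Thm. 3 — not in the tree)
and (ii) some automorphic `P` on `GL_N(𝔸_E)` has, at almost every place, a Satake parameter which is a
base-change Satake parameter of `π` — the printed Cor. 4.3.8, `c(P) = ξ_1(c(π))` outside a finite set,
Mok's trace-formula comparison (Prop. 4.3.4). Combines `isWeakBaseChange_iff` with the automatic
conjugate self-duality. [cite: Mok2014, Cor. 4.3.8 and Prop. 4.3.4] -/
theorem Mok2014_weakBaseChange_iff_forall_eventually_unique_and_exists_matching :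
    Mok2014_weakBaseChange ↔
      ∀ (F E : Type) [Field F] [NumberField F] [Field E] [NumberField E] [Algebra F E] (c : E ≃ₐ[F] E),
        Module.finrank F E = 2 → c ≠ 1 →
        ∀ (N : ℕ) (hcpt : isCompact_glFiniteIntegralLevel N E)
          (π : UnitaryGroup.CuspidalAutomorphicRepData F E c N hcpt), 0 < N →
          (∀ᶠ w : HeightOneSpectrum (𝓞 E) in cofinite, ∀ α β : Multiset ℂ,
              UnitaryGroup.HasBaseChangeSatakeAt F E c N hcpt π.1 w α →
                UnitaryGroup.HasBaseChangeSatakeAt F E c N hcpt π.1 w β → α = β) ∧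
            ∃ P : AutomorphicRepData (AutomorphyDatum.gl N E hcpt),
              ∀ᶠ w : HeightOneSpectrum (𝓞 E) in cofinite, ∃ α : Multiset ℂ,
                UnitaryGroup.HasBaseChangeSatakeAt F E c N hcpt π.1 w α ∧ P.HasSatakeParamAt w α := by
  rw [Mok2014_weakBaseChange_iff_forall_exists_isWeakBaseChange]
  refine forall₂_congr fun F E => forall_congr' fun _ => forall_congr' fun _ => forall_congr' fun _ =>
    forall_congr' fun _ => forall_congr' fun _ => forall_congr' fun c => forall_congr' fun _ =>
    forall_congr' fun _ => forall_congr' fun N => forall_congr' fun hcpt => forall_congr' fun π =>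
    forall_congr' fun _ => ?_
  constructor
  · rintro ⟨P, hP⟩
    exact ⟨hP.eventually_unique, P, hP.eventually_matching⟩
  · rintro ⟨hu, P, hm⟩
    exact ⟨P, UnitaryGroup.isWeakBaseChange_of_eventually_matching hu hm⟩


end Literature.NumberTheory.Automorphic

end
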